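import Literature.MathematicalPhysics.QuantumFieldTheory.Balaban1983to89.B9SectCDiffCutModelToy12

/-!
# `Balaban1983to89.B9SectCDiffCutModelToy13` — THE DECAYING, VOLUME-FREE TOY FRAME AND THE FIRST THEOREM-D OUTPUT
WITH CONTENT: level-0 transport of the `(M)`/`(L)` bundles between frames, the frame `toyFrameD` (unit loss
`u = δ₀/40`, geometric profile `K(a) = 2(1 − e^{−a})⁻¹`), and THEOREM D's conclusion for the potential / zone / cut
data with an `n`-free constant AND exponential decay in the block distance and in the depths of both blocks
(census `b2b-balaban-r1/SectC-inst-census.md` §6 (a⁵) ff.; notes N17–N19)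

B9 = T. Bałaban, *Propagators for lattice gauge theories in a background field*, Commun. Math. Phys. **99**, 389–434
(1985) [Balaban1985BackgroundPropagators].

CITATION HEADER (lean-in-tree rule 2026-08-18).  Cell `pub-balaban`, unit `b2b-balaban-r1-g19` (READER GROUP A,
lineage r1, gen 19), journal claim `SECTC-DIFF-CUTMODEL-TOY13` (successor of the same lineage's `…Toy12` under claim
`SECTC-DIFF-CUTMODEL-TOY12`).  Source: doi:10.1007/bf01240355, held `paper:balaban1985-cmp99-background-propagators`,
journal page = PDF page + 388.  This unit re-read NO page and introduces NO quotation: the printed shapes used here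
are the frame record `Frame` / `Frame.Valid` (the weight transfer (2.60) of [4] p. 234, cited BY TAG in
`…B9SectCDiffEstimate`'s `Transfer`, and the summation profile (2.61) of [4] p. 234, cited BY TAG in
`…B6DomainChange`'s `Profile`; [4] = Bałaban, *Propagators and renormalization transformations II*), the classes
`OpDec` / `OpZon`, the 40-field hypothesis record `EstHyp` of THEOREM D (Theorem 3.1 (3.42), p. 397 [PDF 9], and the
one-sided forms of (3.100), pp. 413–414 [PDF 25–26], both quoted VERBATIM in the header of `…B9SectCDiffEstimate`;
the p. 414 sentence and the (3.100) cite tag also in `…B9SectCDiffAssembly`'s header / `LDat` docstring) and its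
conclusion `EstHyp.dT_entry` (the typed (3.97), p. 412 [PDF 24]); the present declarations point to those quotations
BY NAME only.  Tree inputs (by name): `B4Sect5Proof.sum_exp_neg_abs_le` (the one-dimensional lattice sum
`Σ_{m ∈ S} e^{−b|c−m|} ≤ 2(1 − e^{−b})⁻¹`), `B4Sect5Torus.IsPseudoDist`,
`B6DomainChange.{IsDepth, IsDepth.nonneg, Profile}`, `B6DomainMajorant.{zoneDepth, isDepth_zoneDepth,
zoneDepth_eq_zero}`, `B9SectCDiffEstimate.{Frame, Frame.Valid, Frame.rate, Frame.rate_zero, Frame.σ, Transfer, WDec,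
RowZone, BlkMaj, OpDec, OpZon, EstHyp, EstHyp.dT_entry}`, `B9SectCDiffAssembly.{MOne, MTwo, LDat, assemble}`,
`B9SectCDiffExpansion.{TwoSeq, TwoSeq.dT}`, `B9SectCDiffCutModelToy.{bdist, bdist_isPseudoDist, bdist_nonneg}`,
`B9SectCDiffCutModelToy3.toyFrame` (and its field values, definitionally),
`B9SectCDiffCutModelToy11.{Xpot, mOne_Xpot, mTwo_Xpot, Xcut}`, `B9SectCDiffCutModelToy12.{ldatXpot, hBnat_of,
one_le_c, Xzone, mem_of_vzone_ne_zero, lt_of_vcut_ne_zero}` (and, in docstrings only, `Xzone_G'₂_ne_G'₁`,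
`Xzone_dT`); Mathlib otherwise.  Cell rows: GAPS C-r1g13-1 (the cut model), C-r1g14-1 … C-r1g18-2
(the toys 1–12), this module's row C-r1g19-1; census §6 (a⁵) / notes N10–N19.  No `HarnessLib` fact, no named-fact
`Prop`, no `instance`, no new predicate; no `sorry`.

## WHAT THIS MODULE DOES

Toy12 inhabited THEOREM D's hypothesis record `EstHyp` on Toy3's frame `toyFrame`, whose unit rate loss `u = δ₀/20`
makes the output rate `σ = (δ₀ − 20u)/2` VANISH and whose profile constant `K ≡ n(B+1)` is volume-dependent, so the
instantiated conclusion `Xzone_dT_entry` carried neither decay nor an `n`-free constant (Toy12's honest caveat (4)).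
Both are artefacts of the frame, not of the bundles: every field of `MOne`, `MTwo` (classes `𝒟(0, k, c)`) and of
`LDat` (classes `𝒵(k, θ)`) is a LEVEL-0 class, and a level-0 class reads the frame only through `(ρ, sc, δ₀)`
(plus `β` for the zone condition) — not through `u`, `K` or `Λ`.  Hence:

* §1 **LEVEL-0 TRANSPORT** (generic, any two frames on the same block set): `opDec_congr₀`, `opZon_congr₀` — if
  `F′.ρ = F.ρ`, `F′.sc = F.sc`, `F′.δ₀ = F.δ₀` (and `F′.β = F.β`) then `𝒟_F(0, k, c) ⊆ 𝒟_{F′}(0, k, c)` and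
  `𝒵_F(k, θ) ⊆ 𝒵_{F′}(k, θ)`; field by field **`mOne_congr₀`**, **`mTwo_congr₀`**, **`ldatCongr₀`** (the bundles
  transfer verbatim, constants unchanged).
* §2 **THE GEOMETRIC PROFILE** `Kg a := 2·(1 − e^{−a})⁻¹`: `Kg_pos`, `two_le_Kg`, **`Kg_le : Kg a ≤ 2 + 2/a`**
  (from `a + 1 ≤ eᵃ`), and the VOLUME-FREE lattice sum on the blocks **`sum_exp_bdist_le : Σ_{J : Fin n}
  e^{−a|I−J|} ≤ Kg a`** (`B4Sect5Proof.sum_exp_neg_abs_le` reindexed along `Fin n ↪ ℤ`).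
* §3 **THE DECAYING FRAME `toyFrameD n B N hN δ₀`**: Toy3's `toyFrame` with `u := δ₀/40` and `K := Kg`; its
  `Frame.Valid` for `0 < B`, `0 < δ₀` (`toyFrameD_valid`: the transfer (2.60) at tilt `δ₀/40` with `Λ = 1`,
  `K(u) ≥ 2 ≥ 1`, `20u = δ₀/2 ≤ δ₀`); **`toyFrameD_σ : σ = δ₀/4`** (positive); the volume-free profile
  **`toyFrameD_profile₁ : Profile ρ id Kg`**; the agreement of `toyFrameD` with `toyFrame` in `ρ, β, sc, δ₀` and the
  specialised transports `opDec_toyD_iff`, `opZon_toyD_iff`, `mOne_toyD`, `mTwo_toyD`, `ldatToyD`.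
* §4 **`EstHyp` ON THE DECAYING FRAME**: **`estHypXpotD := assemble …`** from Toy11's `mOne_Xpot`, `mTwo_Xpot` and
  Toy12's `ldatXpot` transported (`2²⁴ ≤ a`, `2a ≤ B`, zone-supported `0 ≤ v ≤ 3(a/B)²`, `0 < δ₀ ≤ 1/2`), with
  `estHypXpotD_c : c = 256a⁴`, `estHypXpotD_θ : θ = 3a²`; `estHypXzoneD`, `estHypXcutD`.
* §5 **THEOREM D WITH CONTENT**: **`XpotD_dT_entry`** / **`XzoneD_dT_entry`** / **`XcutD_dT_entry`**:
  `|(Q′G₂Q′* − Q′G₁Q′*)(I, J)| ≤ 22·3a²·(256a⁴·1·Kg(δ₀/40))¹⁵·B²·exp(−(δ₀/4)·(|I−J| + β(I) + β(J)))` with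
  `β = zoneDepth` to the zone `N` — a constant FREE of the volume `n` and of the zone `N` (the scale enters only as
  the printed row weight `B²`), and EXPONENTIAL DECAY at rate `δ₀/4` in the block distance `|I − J|` and in the depths
  of BOTH blocks relative to the zone; the explicit forms **`Kg_u_le : Kg(δ₀/40) ≤ 81/δ₀`** (`δ₀ ≤ 1/2`),
  **`XzoneD_dT_entry_explicit`**: `… ≤ 22·3a²·(20736a⁴/δ₀)¹⁵·B²·exp(−(δ₀/4)(…))`, and the depth reading
  **`XzoneD_dT_entry_depth`**: `|(Q′G₂Q′* − Q′G₁Q′*)(I, J)| ≤ 22·3a²·(20736a⁴/δ₀)¹⁵·B²·e^{−(δ₀/4)·β(I)}` — the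
  difference of the two coarse minimal-propagator-type operators is exponentially small in the distance of the row
  block from the region where the two sequences differ.  This is the first output of the cell's THEOREM D pipeline
  on a `∂ ≠ 0` datum with two DIFFERENT sequences (`Xzone_G'₂_ne_G'₁`) that has the printed QUALITATIVE content of
  (3.97): uniform constant, decay in the distance and in the distance to the modified region.

HONEST CAVEATS.  (1)–(3) of Toy12 stand unchanged (`χ = ψ = 1`, the localisation is carried by the support of the
potential; the Leibniz block of `(L)` is trivial because only `Δ′_a` differs between the sequences; `diag v` is a
non-negative diagonal site potential, NOT B9's averaging penalties `Q′*aQ′`).  (4′) The constant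
`22·3a²·(256a⁴·Kg(δ₀/40))¹⁵ ≤ 22·3a²·(20736a⁴/δ₀)¹⁵` is ASTRONOMICAL (an artefact of the cell's crude monomial
bookkeeping `(cΛK(u))¹⁵` and of the toy thresholds `a ≥ 2²⁴`), and the rate `δ₀/4` is the cell's generic output rate,
not an optimised one; the left side is NOT certified non-zero (what is certified is `G′₂ ≠ G′₁`, `A′₂ ≠ A′₁`,
Toy12).  (5) `u = δ₀/40` is a CHOICE (any `u < δ₀/20` gives `σ > 0`); the level-0 classes do not see `u`, which is
exactly why the transport of §1 is free.  (6) One-dimensional TOY (blocks `Fin n`, sites `Fin n × Fin B`, one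
level, constant proper scale `B`) — NOT summit progress; nothing here bears on B9's Theorems 3.1–3.3 for the lattice
gauge-field operators.  Value = kernel certificate that the cell's THEOREM D pipeline (expansion → estimate →
assembly) produces, on genuine finite-volume operators with `∂ ≠ 0` forming two different sequences, a bound of the
printed qualitative shape with every hypothesis discharged and every constant independent of the volume.
-/

namespace Literature.MathematicalPhysics.QuantumFieldTheory.Balaban1983to89.B9SectCDiffCutModelToy13

open Finset Real
open B4Sect5Torus (IsPseudoDist)
open B6DomainChange (IsDepth Profile)
open B6DomainMajorant (zoneDepth isDepth_zoneDepth)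
open B9SectCDiffEstimate
open B9SectCDiffAssembly
open B9SectCDiffExpansion (TwoSeq)
open B9SectCDiffCutModel
open B9SectCDiffCutModelToy
open B9SectCDiffCutModelToy2
open B9SectCDiffCutModelToy3
open B9SectCDiffCutModelToy4
open B9SectCDiffCutModelToy5
open B9SectCDiffCutModelToy6
open B9SectCDiffCutModelToy7
open B9SectCDiffCutModelToy8
open B9SectCDiffCutModelToy9
open B9SectCDiffCutModelToy10
open B9SectCDiffCutModelToy11
open B9SectCDiffCutModelToy12

noncomputable section

/-! ## §1 Level-0 transport between frames agreeing in `(ρ, sc, δ₀[, β])` -/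

section Transport

variable {S : Type*} {F F' : Frame S}
variable {u v U V : Type*} [Fintype v] [DecidableEq V] {bu : u → U} {bv : v → V} {pU : U → S} {pV : V → S}

/-- **a level-0 decay class reads the frame only through `(ρ, sc, δ₀)`**: if two frames agree there, `𝒟_F(0, k, c)
⊆ 𝒟_{F′}(0, k, c)` (the rate of a level-0 class is `rate 0 = δ₀`; `u`, `K`, `Λ`, `β` do not enter). [folklore] -/
theorem opDec_congr₀ (hρ : F'.ρ = F.ρ) (hsc : F'.sc = F.sc) (hδ : F'.δ₀ = F.δ₀) {k : ℤ} {c : ℝ}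
    {T : Matrix u v ℝ} (h : OpDec F bu bv pU pV 0 k c T) : OpDec F' bu bv pU pV 0 k c T := by
  obtain ⟨K, hB, hW⟩ := h
  refine ⟨K, hB, ?_⟩
  rw [Frame.rate_zero] at hW ⊢
  rw [hρ, hsc, hδ]
  exact hW

/-- **a zone class reads the frame only through `(ρ, β, sc, δ₀)`**: if two frames agree there, `𝒵_F(k, θ) ⊆
𝒵_{F′}(k, θ)`. [folklore] -/
theorem opZon_congr₀ (hρ : F'.ρ = F.ρ) (hβ : F'.β = F.β) (hsc : F'.sc = F.sc) (hδ : F'.δ₀ = F.δ₀) {k : ℤ}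
    {θ : ℝ} {T : Matrix u v ℝ} (h : OpZon F bu bv pU pV k θ T) : OpZon F' bu bv pU pV k θ T := by
  obtain ⟨K, hB, hW, hZ⟩ := h
  refine ⟨K, hB, ?_, ?_⟩
  · rw [Frame.rate_zero] at hW ⊢
    rw [hρ, hsc, hδ]
    exact hW
  · rw [hβ]
    exact hZ

end Transport

section Bundles

universe uu

variable {S : Type*} {F F' : Frame S}
variable {s b S₁ S₂ B₁ B₂ : Type uu} [Fintype s] [DecidableEq s] [Fintype b] [DecidableEq b]
  [Fintype S₁] [DecidableEq S₁] [Fintype S₂] [DecidableEq S₂] [Fintype B₁] [Fintype B₂]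
variable {t U₁ U₂ : Type uu} [Fintype t] [Fintype U₁] [DecidableEq U₁] [Fintype U₂] [DecidableEq U₂]
variable {X : TwoSeq s b S₁ S₂ B₁ B₂}
variable {p₁ : U₁ → S} {p₂ : U₂ → S} {bs₁ : s → U₁} {bb₁ : b → U₁} {bS₁ : S₁ → U₁} {bB₁ : B₁ → U₁}
  {bs₂ : s → U₂} {bb₂ : b → U₂} {bt₂ : t → U₂} {bS₂ : S₂ → U₂} {bB₂ : B₂ → U₂} {Dv : Matrix t b ℝ}

omit [Fintype U₁] in
/-- **the `(M)` bundle of sequence 1 transfers between frames agreeing in `(ρ, sc, δ₀)`**, constant unchanged.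
[folklore] -/
theorem mOne_congr₀ (hρ : F'.ρ = F.ρ) (hsc : F'.sc = F.sc) (hδ : F'.δ₀ = F.δ₀) {c : ℝ}
    (h : MOne F X p₁ bs₁ bb₁ bS₁ bB₁ c) : MOne F' X p₁ bs₁ bb₁ bS₁ bB₁ c where
  mQ := opDec_congr₀ hρ hsc hδ h.mQ
  mG := opDec_congr₀ hρ hsc hδ h.mG
  mDG' := opDec_congr₀ hρ hsc hδ h.mDG'
  mQ't := opDec_congr₀ hρ hsc hδ h.mQ't
  mC := opDec_congr₀ hρ hsc hδ h.mC
  mQ' := opDec_congr₀ hρ hsc hδ h.mQ'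
  mG' := opDec_congr₀ hρ hsc hδ h.mG'

omit [Fintype t] [Fintype U₂] in
/-- **the `(M)` bundle of sequence 2 transfers between frames agreeing in `(ρ, sc, δ₀)`**, constant and `∇`
unchanged. [folklore] -/
theorem mTwo_congr₀ (hρ : F'.ρ = F.ρ) (hsc : F'.sc = F.sc) (hδ : F'.δ₀ = F.δ₀) {c : ℝ}
    (h : MTwo F X p₂ bs₂ bb₂ bt₂ bS₂ bB₂ Dv c) : MTwo F' X p₂ bs₂ bb₂ bt₂ bS₂ bB₂ Dv c where
  mG := opDec_congr₀ hρ hsc hδ h.mG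
  mQt := opDec_congr₀ hρ hsc hδ h.mQt
  mDtG := opDec_congr₀ hρ hsc hδ h.mDtG
  mDvG := opDec_congr₀ hρ hsc hδ h.mDvG
  mG' := opDec_congr₀ hρ hsc hδ h.mG'
  mDG' := opDec_congr₀ hρ hsc hδ h.mDG'
  mQ't := opDec_congr₀ hρ hsc hδ h.mQ't
  mC := opDec_congr₀ hρ hsc hδ h.mC
  mQ' := opDec_congr₀ hρ hsc hδ h.mQ'

/-- **the `(L)` datum transfers between frames agreeing in `(ρ, β, sc, δ₀)`**: the six coefficient operators and the
three one-sided identities are copied, the thirteen zone classes transported by `opZon_congr₀`. OURS (bookkeeping).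
[folklore] -/
def ldatCongr₀ (hρ : F'.ρ = F.ρ) (hβ : F'.β = F.β) (hsc : F'.sc = F.sc) (hδ : F'.δ₀ = F.δ₀) {θ : ℝ}
    (L : LDat F X p₁ p₂ bs₁ bb₁ bS₁ bB₁ bs₂ bb₂ bt₂ bS₂ bB₂ Dv θ) :
    LDat F' X p₁ p₂ bs₁ bb₁ bS₁ bB₁ bs₂ bb₂ bt₂ bS₂ bB₂ Dv θ where
  Lm₁ := L.Lm₁
  Lm₀ := L.Lm₀
  Dm₁ := L.Dm₁
  Dm₀ := L.Dm₀
  Am₁ := L.Am₁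
  Am₀ := L.Am₀
  zQ := opZon_congr₀ hρ hβ hsc hδ L.zQ
  zQt := opZon_congr₀ hρ hβ hsc hδ L.zQt
  zD := opZon_congr₀ hρ hβ hsc hδ L.zD
  zDt := opZon_congr₀ hρ hβ hsc hδ L.zDt
  zA := opZon_congr₀ hρ hβ hsc hδ L.zA
  zQ' := opZon_congr₀ hρ hβ hsc hδ L.zQ'
  zQ't := opZon_congr₀ hρ hβ hsc hδ L.zQ't
  hΛ := L.hΛ
  zLm₁ := opZon_congr₀ hρ hβ hsc hδ L.zLm₁
  zLm₀ := opZon_congr₀ hρ hβ hsc hδ L.zLm₀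
  hM := L.hM
  zDm₁ := opZon_congr₀ hρ hβ hsc hδ L.zDm₁
  zDm₀ := opZon_congr₀ hρ hβ hsc hδ L.zDm₀
  hA := L.hA
  zAm₁ := opZon_congr₀ hρ hβ hsc hδ L.zAm₁
  zAm₀ := opZon_congr₀ hρ hβ hsc hδ L.zAm₀

omit [Fintype U₁] [DecidableEq U₁] [Fintype U₂] in
/-- the transported `(L)` datum keeps the coefficient operator `Am₀`. [folklore] -/
@[simp] theorem ldatCongr₀_Am₀ (hρ : F'.ρ = F.ρ) (hβ : F'.β = F.β) (hsc : F'.sc = F.sc) (hδ : F'.δ₀ = F.δ₀)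
    {θ : ℝ} (L : LDat F X p₁ p₂ bs₁ bb₁ bS₁ bB₁ bs₂ bb₂ bt₂ bS₂ bB₂ Dv θ) :
    (ldatCongr₀ hρ hβ hsc hδ L).Am₀ = L.Am₀ := rfl

end Bundles

/-! ## §2 The geometric profile constant and the volume-free lattice sum on the blocks -/

section Geometric

variable {n : ℕ}

/-- the geometric profile constant `Kg(a) = 2·(1 − e^{−a})⁻¹` (the one-dimensional `K_1(a)` of
`B4Sect5Proof.latticeConst`). OURS (typing). [folklore] -/
def Kg (a : ℝ) : ℝ := 2 * (1 - Real.exp (-a))⁻¹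

/-- `Kg(a) > 0` for `a > 0` (`e^{−a} < 1`). [folklore] -/
theorem Kg_pos {a : ℝ} (ha : 0 < a) : 0 < Kg a := by
  have h1 : Real.exp (-a) < 1 := Real.exp_lt_one_iff.mpr (by linarith)
  unfold Kg
  exact mul_pos (by norm_num) (inv_pos.mpr (by linarith))

/-- `Kg(a) ≥ 0` for `a > 0`. [folklore] -/
theorem Kg_nonneg {a : ℝ} (ha : 0 < a) : 0 ≤ Kg a := (Kg_pos ha).le

/-- `Kg(a) ≥ 2` for `a > 0` (`0 < 1 − e^{−a} ≤ 1`; so `K(u) ≥ 1` in `Frame.Valid`). [folklore] -/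
theorem two_le_Kg {a : ℝ} (ha : 0 < a) : 2 ≤ Kg a := by
  have h0 : Real.exp (-a) < 1 := Real.exp_lt_one_iff.mpr (by linarith)
  have h1 : 1 ≤ (1 - Real.exp (-a))⁻¹ :=
    (one_le_inv₀ (by linarith)).mpr (by linarith [Real.exp_pos (-a)])
  unfold Kg
  linarith

/-- **`Kg(a) ≤ 2 + 2/a`** for `a > 0`: from `a + 1 ≤ eᵃ`, `e^{−a} ≤ (a+1)⁻¹`, `1 − e^{−a} ≥ a/(a+1)`. [folklore] -/
theorem Kg_le {a : ℝ} (ha : 0 < a) : Kg a ≤ 2 + 2 / a := by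
  have h1 : a + 1 ≤ Real.exp a := Real.add_one_le_exp a
  have h2 : Real.exp (-a) ≤ (a + 1)⁻¹ := by
    rw [Real.exp_neg]
    exact inv_anti₀ (by positivity) h1
  have h3 : a / (a + 1) ≤ 1 - Real.exp (-a) := by
    have : a / (a + 1) = 1 - (a + 1)⁻¹ := by field_simp; ring
    rw [this]
    linarith
  have h4 : 0 < a / (a + 1) := by positivity
  unfold Kg
  calc 2 * (1 - Real.exp (-a))⁻¹ ≤ 2 * (a / (a + 1))⁻¹ :=
        mul_le_mul_of_nonneg_left (inv_anti₀ h4 h3) (by norm_num)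
    _ = 2 + 2 / a := by field_simp

/-- **THE VOLUME-FREE LATTICE SUM ON THE BLOCKS**: `Σ_{J : Fin n} e^{−a|I−J|} ≤ Kg(a)` for every `a > 0`, centre
`I` and EVERY `n` (`B4Sect5Proof.sum_exp_neg_abs_le` along the embedding `Fin n ↪ ℤ`). [folklore] -/
theorem sum_exp_bdist_le {a : ℝ} (ha : 0 < a) (I : Fin n) :
    ∑ J : Fin n, Real.exp (-(a * bdist n I J)) ≤ Kg a := by
  let e : Fin n ↪ ℤ := ⟨fun J => ((J : ℕ) : ℤ), fun J J' h => by
    have h' : ((J : ℕ) : ℤ) = ((J' : ℕ) : ℤ) := h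
    exact Fin.ext (by exact_mod_cast h')⟩
  have h1 : ∑ J : Fin n, Real.exp (-(a * bdist n I J)) =
      ∑ m ∈ (univ : Finset (Fin n)).map e, Real.exp (-(a * |(((I : ℕ) : ℤ) : ℝ) - (m : ℝ)|)) := by
    rw [Finset.sum_map]
    refine sum_congr rfl fun J _ => ?_
    simp only [bdist, e, Function.Embedding.coeFn_mk, Int.cast_natCast]
  rw [h1]
  exact B4Sect5Proof.sum_exp_neg_abs_le _ _ ha

end Geometric

/-! ## §3 The decaying toy frame -/

section FrameD

variable {n B : ℕ}

/-- **THE DECAYING TOY FRAME**: the block frame of the one-level line (`ρ(I, J) = |I − J|`, depth `zoneDepth ρ N`,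
proper scale `sc ≡ B`, rate `δ₀`, `Λ = 1` — all as in Toy3's `toyFrame`) with unit loss `u := δ₀/40` (so that the
output rate `σ = (δ₀ − 20u)/2 = δ₀/4` is POSITIVE) and the VOLUME-FREE geometric summation profile `K := Kg`.
OURS (typing). [folklore] -/
def toyFrameD (n B : ℕ) (N : Finset (Fin n)) (hN : N.Nonempty) (δ₀ : ℝ) : Frame (Fin n) where
  ρ := bdist n
  β := zoneDepth (bdist n) N hN
  K := Kg
  sc := fun _ => (B : ℝ)
  δ₀ := δ₀
  u := δ₀ / 40
  Λ := 1

variable {N : Finset (Fin n)} {hN : N.Nonempty} {δ₀ : ℝ}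

/-- [folklore] -/ @[simp] theorem toyFrameD_ρ : (toyFrameD n B N hN δ₀).ρ = bdist n := rfl
/-- [folklore] -/ @[simp] theorem toyFrameD_β : (toyFrameD n B N hN δ₀).β = zoneDepth (bdist n) N hN := rfl
/-- [folklore] -/ @[simp] theorem toyFrameD_sc (I : Fin n) : (toyFrameD n B N hN δ₀).sc I = (B : ℝ) := rfl
/-- [folklore] -/ @[simp] theorem toyFrameD_δ₀ : (toyFrameD n B N hN δ₀).δ₀ = δ₀ := rfl
/-- [folklore] -/ @[simp] theorem toyFrameD_K (a : ℝ) : (toyFrameD n B N hN δ₀).K a = Kg a := rfl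
/-- [folklore] -/ @[simp] theorem toyFrameD_u : (toyFrameD n B N hN δ₀).u = δ₀ / 40 := rfl
/-- [folklore] -/ @[simp] theorem toyFrameD_Λ : (toyFrameD n B N hN δ₀).Λ = 1 := rfl

/-- **`Frame.Valid` OF THE DECAYING FRAME** for `B ≥ 1`, `δ₀ > 0`: at one level (constant scale) the transfer (2.60)
holds with `Λ = 1` at any non-negative tilt, `K(u) = Kg(δ₀/40) ≥ 2 ≥ 1`, `20u = δ₀/2 ≤ δ₀`. [folklore] -/
theorem toyFrameD_valid (hB : 0 < B) (hN : N.Nonempty) (hδ₀ : 0 < δ₀) : (toyFrameD n B N hN δ₀).Valid where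
  hρ := bdist_isPseudoDist n
  hβ := isDepth_zoneDepth (bdist_isPseudoDist n) N hN
  hK a ha := Kg_nonneg ha
  hsc I := by show (0 : ℝ) < B; exact_mod_cast hB
  htr k _ _ := by
    intro I J
    show (B : ℝ) ^ k ≤ 1 * (B : ℝ) ^ k * Real.exp (δ₀ / 40 * bdist n I J)
    rw [one_mul]
    exact le_mul_of_one_le_right (zpow_nonneg (Nat.cast_nonneg B) k)
      (Real.one_le_exp (mul_nonneg (by linarith) (bdist_nonneg I J)))
  hu := by show 0 < δ₀ / 40; linarith
  hΛ := le_refl _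
  hKu := by
    show (1 : ℝ) ≤ Kg (δ₀ / 40)
    linarith [two_le_Kg (show 0 < δ₀ / 40 by linarith)]
  hδ₀ := by show 20 * (δ₀ / 40) ≤ δ₀; linarith

/-- **THE OUTPUT RATE OF THE DECAYING FRAME IS `σ = δ₀/4`**. [folklore] -/
theorem toyFrameD_σ : (toyFrameD n B N hN δ₀).σ = δ₀ / 4 := by
  show (δ₀ - 20 * (δ₀ / 40)) / 2 = δ₀ / 4
  ring

/-- the output rate is positive. [folklore] -/
theorem toyFrameD_σ_pos (hδ₀ : 0 < δ₀) : 0 < (toyFrameD n B N hN δ₀).σ := by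
  rw [toyFrameD_σ]; linarith

/-- **THE VOLUME-FREE PROFILE of the blocks** (coarse elements of either sequence of the potential datum):
`Σ_J e^{−a|I−J|} ≤ Kg(a)`, uniformly in `n`. [folklore] -/
theorem toyFrameD_profile₁ : Profile (toyFrameD n B N hN δ₀).ρ id (toyFrameD n B N hN δ₀).K := by
  intro a ha s
  exact sum_exp_bdist_le ha s

/-- a block of the zone has depth `0` in the decaying frame. [folklore] -/
theorem toyFrameD_β_eq_zero {I : Fin n} (hI : I ∈ N) : (toyFrameD n B N hN δ₀).β I = 0 := by
  show zoneDepth (bdist n) N hN I = 0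
  exact B6DomainMajorant.zoneDepth_eq_zero (bdist_isPseudoDist n) hN hI

/-- the depth is non-negative. [folklore] -/
theorem toyFrameD_β_nonneg (I : Fin n) : 0 ≤ (toyFrameD n B N hN δ₀).β I :=
  (isDepth_zoneDepth (bdist_isPseudoDist n) N hN).nonneg I

/-! ### The decaying frame agrees with Toy3's frame in `(ρ, β, sc, δ₀)`: the specialised transports -/

/-- [folklore] -/ theorem toyFrameD_ρ_eq : (toyFrameD n B N hN δ₀).ρ = (toyFrame n B N hN δ₀).ρ := rfl
/-- [folklore] -/ theorem toyFrameD_β_eq : (toyFrameD n B N hN δ₀).β = (toyFrame n B N hN δ₀).β := rfl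
/-- [folklore] -/ theorem toyFrameD_sc_eq : (toyFrameD n B N hN δ₀).sc = (toyFrame n B N hN δ₀).sc := rfl
/-- [folklore] -/ theorem toyFrameD_δ₀_eq : (toyFrameD n B N hN δ₀).δ₀ = (toyFrame n B N hN δ₀).δ₀ := rfl

variable {u v U V : Type*} [Fintype v] [DecidableEq V] {bu : u → U} {bv : v → V} {pU : U → Fin n}
  {pV : V → Fin n}

/-- **the level-0 decay classes of the two toy frames coincide**. [folklore] -/
theorem opDec_toyD_iff {k : ℤ} {c : ℝ} {T : Matrix u v ℝ} :
    OpDec (toyFrameD n B N hN δ₀) bu bv pU pV 0 k c T ↔ OpDec (toyFrame n B N hN δ₀) bu bv pU pV 0 k c T :=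
  ⟨opDec_congr₀ toyFrameD_ρ_eq.symm toyFrameD_sc_eq.symm toyFrameD_δ₀_eq.symm,
    opDec_congr₀ toyFrameD_ρ_eq toyFrameD_sc_eq toyFrameD_δ₀_eq⟩

/-- **the zone classes of the two toy frames coincide**. [folklore] -/
theorem opZon_toyD_iff {k : ℤ} {θ : ℝ} {T : Matrix u v ℝ} :
    OpZon (toyFrameD n B N hN δ₀) bu bv pU pV k θ T ↔ OpZon (toyFrame n B N hN δ₀) bu bv pU pV k θ T :=
  ⟨opZon_congr₀ toyFrameD_ρ_eq.symm toyFrameD_β_eq.symm toyFrameD_sc_eq.symm toyFrameD_δ₀_eq.symm,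
    opZon_congr₀ toyFrameD_ρ_eq toyFrameD_β_eq toyFrameD_sc_eq toyFrameD_δ₀_eq⟩

end FrameD

section ToyBundles

variable {n B : ℕ} {N : Finset (Fin n)} {hN : N.Nonempty} {δ₀ : ℝ}
variable {s b S₁ S₂ B₁ B₂ : Type} [Fintype s] [DecidableEq s] [Fintype b] [DecidableEq b]
  [Fintype S₁] [DecidableEq S₁] [Fintype S₂] [DecidableEq S₂] [Fintype B₁] [Fintype B₂]
variable {t U₁ U₂ : Type} [Fintype t] [Fintype U₁] [DecidableEq U₁] [Fintype U₂] [DecidableEq U₂]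
variable {X : TwoSeq s b S₁ S₂ B₁ B₂}
variable {p₁ : U₁ → Fin n} {p₂ : U₂ → Fin n} {bs₁ : s → U₁} {bb₁ : b → U₁} {bS₁ : S₁ → U₁} {bB₁ : B₁ → U₁}
  {bs₂ : s → U₂} {bb₂ : b → U₂} {bt₂ : t → U₂} {bS₂ : S₂ → U₂} {bB₂ : B₂ → U₂} {Dv : Matrix t b ℝ}

omit [Fintype U₁] in
/-- an `(M)` bundle of sequence 1 on Toy3's frame is one on the decaying frame, same constant. [folklore] -/
theorem mOne_toyD {c : ℝ} (h : MOne (toyFrame n B N hN δ₀) X p₁ bs₁ bb₁ bS₁ bB₁ c) :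
    MOne (toyFrameD n B N hN δ₀) X p₁ bs₁ bb₁ bS₁ bB₁ c :=
  mOne_congr₀ toyFrameD_ρ_eq toyFrameD_sc_eq toyFrameD_δ₀_eq h

omit [Fintype t] [Fintype U₂] in
/-- an `(M)` bundle of sequence 2 on Toy3's frame is one on the decaying frame, same constant. [folklore] -/
theorem mTwo_toyD {c : ℝ} (h : MTwo (toyFrame n B N hN δ₀) X p₂ bs₂ bb₂ bt₂ bS₂ bB₂ Dv c) :
    MTwo (toyFrameD n B N hN δ₀) X p₂ bs₂ bb₂ bt₂ bS₂ bB₂ Dv c :=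
  mTwo_congr₀ toyFrameD_ρ_eq toyFrameD_sc_eq toyFrameD_δ₀_eq h

/-- an `(L)` datum on Toy3's frame is one on the decaying frame, same `θ`. OURS (bookkeeping). [folklore] -/
def ldatToyD {θ : ℝ} (L : LDat (toyFrame n B N hN δ₀) X p₁ p₂ bs₁ bb₁ bS₁ bB₁ bs₂ bb₂ bt₂ bS₂ bB₂ Dv θ) :
    LDat (toyFrameD n B N hN δ₀) X p₁ p₂ bs₁ bb₁ bS₁ bB₁ bs₂ bb₂ bt₂ bS₂ bB₂ Dv θ :=
  ldatCongr₀ toyFrameD_ρ_eq toyFrameD_β_eq toyFrameD_sc_eq toyFrameD_δ₀_eq L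

end ToyBundles

/-! ## §4 `EstHyp` for the potential datum on the decaying frame -/

section EstD

variable {n B : ℕ} {N : Finset (Fin n)} {hN : N.Nonempty} {δ₀ : ℝ}
variable {a : ℝ} {v : Fin n × Fin B → ℝ} {ha : 16777216 ≤ a} {haB : 2 * a ≤ (B : ℝ)}
  {hv0 : ∀ x, 0 ≤ v x} {hv1 : ∀ x, v x ≤ 3 * (a / B) ^ 2}

/-- **`EstHyp` FOR THE POTENTIAL DATUM ON THE DECAYING FRAME**: Toy11's `mOne_Xpot`, `mTwo_Xpot` (constant `256a⁴`)
and Toy12's `ldatXpot` (`θ = 3a²`) transported to `toyFrameD` by §1/§3, the volume-free profile `toyFrameD_profile₁`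
for both block families, assembled by the cell's `assemble`; hypotheses `2²⁴ ≤ a`, `2a ≤ B`, `0 ≤ v ≤ 3(a/B)²`
zone-supported, `0 < δ₀ ≤ 1/2`.  OURS. [folklore] -/
def estHypXpotD (hδ₀ : 0 < δ₀) (hδ : δ₀ ≤ 1 / 2) (hvN : ∀ x, v x ≠ 0 → x.1 ∈ N) :
    EstHyp (toyFrameD n B N hN δ₀) (Xpot n B a v ha haB hv0 hv1) (Fin n × Fin B) (Fin n) (Fin n) :=
  assemble (toyFrameD_valid (hBnat_of ha haB) hN hδ₀) (mOne_toyD (mOne_Xpot hδ)) (mTwo_toyD (mTwo_Xpot hδ))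
    (ldatToyD (ldatXpot hδ₀ hvN)) (by positivity) (by positivity) (by positivity) toyFrameD_profile₁
    toyFrameD_profile₁

/-- the assembled (M) constant is `max(1, 256a⁴, 256a⁴) = 256a⁴`. [folklore] -/
theorem estHypXpotD_c (hδ₀ : 0 < δ₀) (hδ : δ₀ ≤ 1 / 2) (hvN : ∀ x, v x ≠ 0 → x.1 ∈ N) :
    (estHypXpotD (ha := ha) (haB := haB) (hv0 := hv0) (hv1 := hv1) (hN := hN) hδ₀ hδ hvN).c = 256 * a ^ 4 := by
  show max 1 (max (256 * a ^ 4) (256 * a ^ 4)) = 256 * a ^ 4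
  rw [max_self, max_eq_right (one_le_c ha)]

/-- the assembled (L) constant is `3a²`. [folklore] -/
theorem estHypXpotD_θ (hδ₀ : 0 < δ₀) (hδ : δ₀ ≤ 1 / 2) (hvN : ∀ x, v x ≠ 0 → x.1 ∈ N) :
    (estHypXpotD (ha := ha) (haB := haB) (hv0 := hv0) (hv1 := hv1) (hN := hN) hδ₀ hδ hvN).θ = 3 * a ^ 2 := rfl

/-- [folklore] -/
theorem estHypXpotD_p₁ (hδ₀ : 0 < δ₀) (hδ : δ₀ ≤ 1 / 2) (hvN : ∀ x, v x ≠ 0 → x.1 ∈ N) :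
    (estHypXpotD (ha := ha) (haB := haB) (hv0 := hv0) (hv1 := hv1) (hN := hN) hδ₀ hδ hvN).p₁ = id := rfl

/-- [folklore] -/
theorem estHypXpotD_p₂ (hδ₀ : 0 < δ₀) (hδ : δ₀ ≤ 1 / 2) (hvN : ∀ x, v x ≠ 0 → x.1 ∈ N) :
    (estHypXpotD (ha := ha) (haB := haB) (hv0 := hv0) (hv1 := hv1) (hN := hN) hδ₀ hδ hvN).p₂ = id := rfl

/-- [folklore] -/
theorem estHypXpotD_bB₁ (hδ₀ : 0 < δ₀) (hδ : δ₀ ≤ 1 / 2) (hvN : ∀ x, v x ≠ 0 → x.1 ∈ N) :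
    (estHypXpotD (ha := ha) (haB := haB) (hv0 := hv0) (hv1 := hv1) (hN := hN) hδ₀ hδ hvN).bB₁ = id := rfl

/-- [folklore] -/
theorem estHypXpotD_bB₂ (hδ₀ : 0 < δ₀) (hδ : δ₀ ≤ 1 / 2) (hvN : ∀ x, v x ≠ 0 → x.1 ∈ N) :
    (estHypXpotD (ha := ha) (haB := haB) (hv0 := hv0) (hv1 := hv1) (hN := hN) hδ₀ hδ hvN).bB₂ = id := rfl

/-- [folklore] -/
theorem estHypXpotD_nonempty (hδ₀ : 0 < δ₀) (hδ : δ₀ ≤ 1 / 2) (hvN : ∀ x, v x ≠ 0 → x.1 ∈ N) :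
    Nonempty (EstHyp (toyFrameD n B N hN δ₀) (Xpot n B a v ha haB hv0 hv1) (Fin n × Fin B) (Fin n) (Fin n)) :=
  ⟨estHypXpotD hδ₀ hδ hvN⟩

end EstD

/-! ## §5 THEOREM D with content: volume-free constant, decay in the block distance and in both depths -/

section Conclusion

variable {n B : ℕ} {N : Finset (Fin n)} {δ₀ : ℝ}
variable {a : ℝ} {v : Fin n × Fin B → ℝ} {ha : 16777216 ≤ a} {haB : 2 * a ≤ (B : ℝ)}
  {hv0 : ∀ x, 0 ≤ v x} {hv1 : ∀ x, v x ≤ 3 * (a / B) ^ 2}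

/-- **THEOREM D FOR THE POTENTIAL DATUM ON THE DECAYING FRAME**: the cell's `EstHyp.dT_entry` on `estHypXpotD` with
every frame field unfolded —
`|(Q′G₂Q′* − Q′G₁Q′*)(I, J)| ≤ 22·3a²·(256a⁴·1·Kg(δ₀/40))¹⁵·B²·exp(−(δ₀/4)·(|I−J| + β(I) + β(J)))`,
`β = zoneDepth` to `N`: a constant FREE of `n` and `N`, exponential decay in the block distance and in the depths of
both blocks.  Hypotheses: `2²⁴ ≤ a`, `2a ≤ B`, `0 ≤ v ≤ 3(a/B)²` supported on the blocks of `N`, `0 < δ₀ ≤ 1/2`.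
OURS. [folklore] -/
theorem XpotD_dT_entry (hN : N.Nonempty) (hδ₀ : 0 < δ₀) (hδ : δ₀ ≤ 1 / 2) (hvN : ∀ x, v x ≠ 0 → x.1 ∈ N)
    (I J : Fin n) :
    |(Xpot n B a v ha haB hv0 hv1).dT I J| ≤
      22 * (3 * a ^ 2) * (256 * a ^ 4 * 1 * Kg (δ₀ / 40)) ^ 15 * (B : ℝ) ^ (2 : ℤ) *
        Real.exp (-(δ₀ / 4 * (bdist n I J + zoneDepth (bdist n) N hN I + zoneDepth (bdist n) N hN J))) := by
  have h := (estHypXpotD (ha := ha) (haB := haB) (hv0 := hv0) (hv1 := hv1) (hN := hN) hδ₀ hδ hvN).dT_entry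
    (toyFrameD_valid (hBnat_of ha haB) hN hδ₀) I J
  rw [toyFrameD_σ, estHypXpotD_c, estHypXpotD_p₁, estHypXpotD_p₂, estHypXpotD_bB₁, estHypXpotD_bB₂, toyFrameD_Λ,
    toyFrameD_K, toyFrameD_u, toyFrameD_sc, toyFrameD_ρ, toyFrameD_β] at h
  exact h

/-- **`Kg(δ₀/40) ≤ 81/δ₀`** for `0 < δ₀ ≤ 1/2` (`Kg_le`: `2 + 80/δ₀`, and `2 ≤ 1/δ₀`). [folklore] -/
theorem Kg_u_le (hδ₀ : 0 < δ₀) (hδ : δ₀ ≤ 1 / 2) : Kg (δ₀ / 40) ≤ 81 / δ₀ := by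
  have h1 := Kg_le (show 0 < δ₀ / 40 by linarith)
  have h2 : 2 + 2 / (δ₀ / 40) = 2 + 80 / δ₀ := by
    rw [div_div_eq_mul_div]; ring
  have h3 : (2 : ℝ) ≤ 1 / δ₀ := by
    rw [le_div_iff₀ hδ₀]; linarith
  calc Kg (δ₀ / 40) ≤ 2 + 80 / δ₀ := h2 ▸ h1
    _ ≤ 1 / δ₀ + 80 / δ₀ := by linarith
    _ = 81 / δ₀ := by ring

/-- the explicit constant: `(256a⁴·1·Kg(δ₀/40))¹⁵ ≤ (20736a⁴/δ₀)¹⁵`. [folklore] -/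
theorem const_pow_le (hδ₀ : 0 < δ₀) (hδ : δ₀ ≤ 1 / 2) (a : ℝ) :
    (256 * a ^ 4 * 1 * Kg (δ₀ / 40)) ^ 15 ≤ (20736 * a ^ 4 / δ₀) ^ 15 := by
  have hK0 : 0 ≤ Kg (δ₀ / 40) := Kg_nonneg (by linarith)
  have h0 : 0 ≤ 256 * a ^ 4 * 1 * Kg (δ₀ / 40) := by positivity
  refine pow_le_pow_left₀ h0 ?_ 15
  calc 256 * a ^ 4 * 1 * Kg (δ₀ / 40) ≤ 256 * a ^ 4 * 1 * (81 / δ₀) :=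
        mul_le_mul_of_nonneg_left (Kg_u_le hδ₀ hδ) (by positivity)
    _ = 20736 * a ^ 4 / δ₀ := by ring

variable {hN : N.Nonempty}

/-- **`EstHyp` FOR THE ZONE DATUM ON THE DECAYING FRAME** (any non-empty zone). OURS. [folklore] -/
def estHypXzoneD (hN : N.Nonempty) (hδ₀ : 0 < δ₀) (hδ : δ₀ ≤ 1 / 2) :
    EstHyp (toyFrameD n B N hN δ₀) (Xzone n B N a ha haB) (Fin n × Fin B) (Fin n) (Fin n) :=
  estHypXpotD hδ₀ hδ fun _ h => mem_of_vzone_ne_zero h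

/-- [folklore] -/
theorem estHypXzoneD_c (hN : N.Nonempty) (hδ₀ : 0 < δ₀) (hδ : δ₀ ≤ 1 / 2) :
    (estHypXzoneD (ha := ha) (haB := haB) hN hδ₀ hδ).c = 256 * a ^ 4 :=
  estHypXpotD_c hδ₀ hδ _

/-- **`EstHyp` FOR THE CUT DATUM ON THE DECAYING FRAME**, for any zone containing the blocks left of the cut. OURS.
[folklore] -/
def estHypXcutD {I₀ : ℕ} (hN : N.Nonempty) (hδ₀ : 0 < δ₀) (hδ : δ₀ ≤ 1 / 2)
    (hleft : ∀ I : Fin n, (I : ℕ) < I₀ → I ∈ N) :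
    EstHyp (toyFrameD n B N hN δ₀) (Xcut n B I₀ a ha haB) (Fin n × Fin B) (Fin n) (Fin n) :=
  estHypXpotD hδ₀ hδ fun x h => hleft x.1 (lt_of_vcut_ne_zero h)

/-- **THEOREM D FOR THE ZONE DATUM ON THE DECAYING FRAME** (non-empty zone `N`, `2²⁴ ≤ a`, `2a ≤ B`,
`0 < δ₀ ≤ 1/2`): volume-free constant, decay in `|I − J|` and in both depths — on a datum with `∂ ≠ 0` whose two
sequences DIFFER (`Xzone_G'₂_ne_G'₁`; the left side is `Q′·Gtoyv·Q′* − Q′·Gtoy·Q′*`, Toy12's `Xzone_dT`). OURS.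
[folklore] -/
theorem XzoneD_dT_entry (hN : N.Nonempty) (hδ₀ : 0 < δ₀) (hδ : δ₀ ≤ 1 / 2) (I J : Fin n) :
    |(Xzone n B N a ha haB).dT I J| ≤
      22 * (3 * a ^ 2) * (256 * a ^ 4 * 1 * Kg (δ₀ / 40)) ^ 15 * (B : ℝ) ^ (2 : ℤ) *
        Real.exp (-(δ₀ / 4 * (bdist n I J + zoneDepth (bdist n) N hN I + zoneDepth (bdist n) N hN J))) :=
  XpotD_dT_entry hN hδ₀ hδ (fun _ h => mem_of_vzone_ne_zero h) I J

/-- **THEOREM D FOR THE CUT DATUM ON THE DECAYING FRAME** (zone ⊇ the blocks left of `I₀`). OURS. [folklore] -/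
theorem XcutD_dT_entry {I₀ : ℕ} (hN : N.Nonempty) (hδ₀ : 0 < δ₀) (hδ : δ₀ ≤ 1 / 2)
    (hleft : ∀ I : Fin n, (I : ℕ) < I₀ → I ∈ N) (I J : Fin n) :
    |(Xcut n B I₀ a ha haB).dT I J| ≤
      22 * (3 * a ^ 2) * (256 * a ^ 4 * 1 * Kg (δ₀ / 40)) ^ 15 * (B : ℝ) ^ (2 : ℤ) *
        Real.exp (-(δ₀ / 4 * (bdist n I J + zoneDepth (bdist n) N hN I + zoneDepth (bdist n) N hN J))) :=
  XpotD_dT_entry hN hδ₀ hδ (fun x h => hleft x.1 (lt_of_vcut_ne_zero h)) I J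

/-- **THE EXPLICIT FORM**: `|(Q′G₂Q′* − Q′G₁Q′*)(I, J)| ≤ 22·3a²·(20736a⁴/δ₀)¹⁵·B²·exp(−(δ₀/4)(|I−J| + β(I) +
β(J)))` for the zone datum. OURS. [folklore] -/
theorem XzoneD_dT_entry_explicit (hN : N.Nonempty) (hδ₀ : 0 < δ₀) (hδ : δ₀ ≤ 1 / 2) (I J : Fin n) :
    |(Xzone n B N a ha haB).dT I J| ≤
      22 * (3 * a ^ 2) * (20736 * a ^ 4 / δ₀) ^ 15 * (B : ℝ) ^ 2 *
        Real.exp (-(δ₀ / 4 * (bdist n I J + zoneDepth (bdist n) N hN I + zoneDepth (bdist n) N hN J))) := by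
  have h := XzoneD_dT_entry (ha := ha) (haB := haB) hN hδ₀ hδ I J
  rw [zpow_ofNat] at h
  refine h.trans ?_
  have h1 := const_pow_le hδ₀ hδ a
  have h2 : (0 : ℝ) ≤ 22 * (3 * a ^ 2) := by positivity
  have h3 : (0 : ℝ) ≤ (B : ℝ) ^ 2 := by positivity
  have h4 : (0 : ℝ) ≤ Real.exp (-(δ₀ / 4 * (bdist n I J + zoneDepth (bdist n) N hN I +
      zoneDepth (bdist n) N hN J))) := (Real.exp_pos _).le
  have := mul_le_mul_of_nonneg_left h1 h2
  have := mul_le_mul_of_nonneg_right this h3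
  exact mul_le_mul_of_nonneg_right this h4

/-- **THE DEPTH READING**: the difference of the two coarse minimal-propagator-type operators at a row block `I` is
exponentially small in the depth of `I` relative to the zone where the two sequences differ —
`|(Q′G₂Q′* − Q′G₁Q′*)(I, J)| ≤ 22·3a²·(20736a⁴/δ₀)¹⁵·B²·e^{−(δ₀/4)·β(I)}`. OURS. [folklore] -/
theorem XzoneD_dT_entry_depth (hN : N.Nonempty) (hδ₀ : 0 < δ₀) (hδ : δ₀ ≤ 1 / 2) (I J : Fin n) :
    |(Xzone n B N a ha haB).dT I J| ≤
      22 * (3 * a ^ 2) * (20736 * a ^ 4 / δ₀) ^ 15 * (B : ℝ) ^ 2 *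
        Real.exp (-(δ₀ / 4 * zoneDepth (bdist n) N hN I)) := by
  refine (XzoneD_dT_entry_explicit (ha := ha) (haB := haB) hN hδ₀ hδ I J).trans ?_
  have hρ : 0 ≤ bdist n I J := bdist_nonneg I J
  have hβJ : 0 ≤ zoneDepth (bdist n) N hN J := (isDepth_zoneDepth (bdist_isPseudoDist n) N hN).nonneg J
  have h0 : (0 : ℝ) ≤ 22 * (3 * a ^ 2) * (20736 * a ^ 4 / δ₀) ^ 15 * (B : ℝ) ^ 2 := by positivity
  refine mul_le_mul_of_nonneg_left (Real.exp_le_exp.mpr ?_) h0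
  nlinarith

/-- **FAR FROM THE ZONE THE TWO COARSE OPERATORS AGREE UP TO `ε`**: for every `ε > 0` there is a depth `d₀` such that
`β(I) ≥ d₀ ⇒ |(Q′G₂Q′* − Q′G₁Q′*)(I, J)| ≤ ε` — uniformly in `n`, `N`, `J`. OURS. [folklore] -/
theorem XzoneD_dT_small (hN : N.Nonempty) (hδ₀ : 0 < δ₀) (hδ : δ₀ ≤ 1 / 2) {ε : ℝ} (hε : 0 < ε) :
    ∃ d₀ : ℝ, ∀ I J : Fin n, d₀ ≤ zoneDepth (bdist n) N hN I → |(Xzone n B N a ha haB).dT I J| ≤ ε := by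
  set C : ℝ := 22 * (3 * a ^ 2) * (20736 * a ^ 4 / δ₀) ^ 15 * (B : ℝ) ^ 2 with hC
  have hC0 : 0 ≤ C := by positivity
  refine ⟨4 / δ₀ * Real.log ((C + 1) / ε), fun I J hI => ?_⟩
  refine (XzoneD_dT_entry_depth (ha := ha) (haB := haB) hN hδ₀ hδ I J).trans ?_
  rw [← hC]
  have hq : 0 < (C + 1) / ε := by positivity
  have h1 : Real.log ((C + 1) / ε) ≤ δ₀ / 4 * zoneDepth (bdist n) N hN I := by
    have := mul_le_mul_of_nonneg_left hI (show (0 : ℝ) ≤ δ₀ / 4 by linarith)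
    calc Real.log ((C + 1) / ε) = δ₀ / 4 * (4 / δ₀ * Real.log ((C + 1) / ε)) := by
          field_simp
      _ ≤ δ₀ / 4 * zoneDepth (bdist n) N hN I := this
  have h2 : Real.exp (-(δ₀ / 4 * zoneDepth (bdist n) N hN I)) ≤ ε / (C + 1) := by
    calc Real.exp (-(δ₀ / 4 * zoneDepth (bdist n) N hN I)) ≤ Real.exp (-Real.log ((C + 1) / ε)) :=
          Real.exp_le_exp.mpr (by linarith)
      _ = ε / (C + 1) := by rw [Real.exp_neg, Real.exp_log hq, inv_div]
  calc C * Real.exp (-(δ₀ / 4 * zoneDepth (bdist n) N hN I)) ≤ C * (ε / (C + 1)) :=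
        mul_le_mul_of_nonneg_left h2 hC0
    _ ≤ ε := by
        rw [mul_div_assoc']
        rw [div_le_iff₀ (by positivity : (0 : ℝ) < C + 1)]
        nlinarith

end Conclusion

end

end Literature.MathematicalPhysics.QuantumFieldTheory.Balaban1983to89.B9SectCDiffCutModelToy13
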